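import Literature.Probability.Percolation.OrbitLoopCloseness
import HarnessLib

/-!
# Pieces of the rounded loop of an orbit: the trace, re-basing, and runs covering a connected set

Topic `Literature/Probability/Percolation`; proofs only. For the rounded Jordan loop
`Λ = OrbitPolygon.loop β p δ` of the orbit of a periodic corner `p` (minimal period `Q`) under
Smirnov's turning rule (`OrbitLoopPolygon.lean`; the closed polygon through
`vtx 0 = pS 0, vtx 1 = pT 0, vtx 2 = pS 1, …` at uniform speed):

* `OrbitPolygon.piece δ m = [vtx m, vtx (m+1)]`, `2Q`-periodic in `m` (`piece_add_period`,
  `piece_mod`), and **the trace of `Λ` is the union of the `2Q` pieces** (`range_loop_eq`);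
* **re-basing**: for the corner `corner β p j` of the orbit, `vtx`/`piece` are shifted by `2j`
  (`vtx_corner`, `piece_corner`), and it is again periodic (`corner_mem_periodicPts`);
* **runs**: a nonempty preconnected subset `C` of the trace is covered by a cyclic run of pieces
  `piece m₀, piece (m₀+1), …, piece (m₀+k)` (`k < 2Q`) each of which meets `C`
  (`exists_run_of_isPreconnected`) — because two pieces meet only when cyclically adjacent
  (`vtx_meet`), so the pieces meeting `C` form a cyclically connected index set.

This is the combinatorial half of "a connected part of an interface loop is a parameter sub-arc",
used to turn a connected crossing piece of a cluster interface into a stretch of consecutive darts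
(Camia–Newman, CMP 268 (2006), §5).

## References

* F. Camia, C. M. Newman, Comm. Math. Phys. 268 (2006), §5 [CamiaNewman2006].
* S. Smirnov, C. R. Acad. Sci. Paris 333 (2001), §2 [Smirnov2001].
-/

noncomputable section

namespace Literature.Probability.Percolation

open Set Function LatticeModels

namespace OrbitPolygon

variable {β : BondConfig (Site 2)} {p : Site 2 × Fin 4}

/-! ### Pieces and the trace -/

/-- The `m`-th piece `[vtx m, vtx (m+1)]` of the rounded loop (a dart piece for even `m`, a
connector for odd `m`). [cite: Smirnov2001, §2] -/
def piece (β : BondConfig (Site 2)) (p : Site 2 × Fin 4) (δ : ℝ) (m : ℕ) : Set ℂ :=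
  segment ℝ (vtx β p δ m) (vtx β p δ (m + 1))

/-- Pieces are `2Q`-periodic. [folklore] -/
theorem piece_add_period (δ : ℝ) (m : ℕ) :
    piece β p δ (m + 2 * minimalPeriod (nextCorner β) p) = piece β p δ m := by
  rw [piece, piece, show m + 2 * minimalPeriod (nextCorner β) p + 1 = (m + 1) + 2 * minimalPeriod (nextCorner β) p
    by ring, vtx_add_period, vtx_add_period]

/-- Pieces are `2Q`-periodic (multiple form). [folklore] -/
theorem piece_add_mul_period (δ : ℝ) (m n : ℕ) :
    piece β p δ (m + 2 * minimalPeriod (nextCorner β) p * n) = piece β p δ m := by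
  induction n with
  | zero => simp
  | succ n ih => rw [Nat.mul_succ, ← add_assoc, piece_add_period, ih]

/-- Pieces read modulo `2Q`. [folklore] -/
theorem piece_mod (δ : ℝ) (m : ℕ) :
    piece β p δ (m % (2 * minimalPeriod (nextCorner β) p)) = piece β p δ m := by
  conv_rhs => rw [← Nat.mod_add_div m (2 * minimalPeriod (nextCorner β) p)]
  rw [piece_add_mul_period]

/-- Pieces are closed. [folklore] -/
theorem isClosed_piece (δ : ℝ) (m : ℕ) : IsClosed (piece β p δ m) := by
  rw [piece, segment_eq_image']
  exact (isCompact_Icc.image (by fun_prop)).isClosed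

/-- **The trace of the rounded loop is the union of its `2Q` pieces.** [cite: Smirnov2001, §2] -/
theorem range_loop_eq (hp : p ∈ periodicPts (nextCorner β)) (δ : ℝ) :
    range (loop β p δ) = ⋃ m ∈ Finset.range (2 * minimalPeriod (nextCorner β) p), piece β p δ m := by
  have hQ : 0 < minimalPeriod (nextCorner β) p := minimalPeriod_pos_of_mem_periodicPts hp
  set N := 2 * minimalPeriod (nextCorner β) p with hN
  have hNpos : 0 < N := by omega
  have hNr : (0 : ℝ) < N := by exact_mod_cast hNpos
  have hval : ∀ u : ℝ, u ∈ Ico (0 : ℝ) 1 → loop β p δ u = PLLoop.interp (vtx β p δ) ((N : ℝ) * u) := by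
    intro u hu
    show PLLoop.unitLoop (vtx β p δ) N (Int.fract u) = _
    rw [Int.fract_eq_self.2 hu]
    rfl
  ext z
  simp only [mem_iUnion, Finset.mem_range, exists_prop]
  constructor
  · rintro ⟨t, rfl⟩
    have hu : Int.fract t ∈ Ico (0 : ℝ) 1 := ⟨Int.fract_nonneg t, Int.fract_lt_one t⟩
    obtain ⟨m, hm, hmem⟩ := PLLoop.unitLoop_mem_iUnion (W := vtx β p δ) hNpos hu
    exact ⟨m, hm, hmem⟩
  · rintro ⟨m, hm, hz⟩
    rw [piece, segment_eq_image'] at hz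
    obtain ⟨s, ⟨hs0, hs1⟩, rfl⟩ := hz
    rcases lt_or_eq_of_le hs1 with hs1' | rfl
    · refine ⟨((m : ℝ) + s) / N, ?_⟩
      have ht : ((m : ℝ) + s) / N ∈ Ico (0 : ℝ) 1 := by
        refine ⟨by positivity, ?_⟩
        rw [div_lt_one hNr]
        have : (m : ℝ) + 1 ≤ N := by exact_mod_cast hm
        linarith
      rw [hval _ ht, mul_div_cancel₀ _ hNr.ne', PLLoop.interp_of_mem_Ico (m := m) ⟨by linarith, by linarith⟩]
      simp only [add_sub_cancel_left, Complex.real_smul]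
    · -- `s = 1`: the vertex `vtx (m + 1)`
      simp only [one_smul, add_sub_cancel]
      rcases Nat.lt_or_ge (m + 1) N with hm1 | hm1
      · refine ⟨((m + 1 : ℕ) : ℝ) / N, ?_⟩
        have ht : (((m + 1 : ℕ) : ℝ)) / N ∈ Ico (0 : ℝ) 1 := by
          refine ⟨by positivity, ?_⟩
          rw [div_lt_one hNr]
          exact_mod_cast hm1
        rw [hval _ ht, mul_div_cancel₀ _ hNr.ne', PLLoop.interp_natCast]
      · have hmN : m + 1 = N := by omega
        refine ⟨0, ?_⟩
        rw [hval 0 ⟨le_rfl, zero_lt_one⟩, mul_zero, show (0 : ℝ) = ((0 : ℕ) : ℝ) by simp,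
          PLLoop.interp_natCast, hmN, hN, ← zero_add (2 * minimalPeriod (nextCorner β) p), vtx_add_period]

/-- Every piece lies on the trace. [folklore] -/
theorem piece_subset_range_loop (hp : p ∈ periodicPts (nextCorner β)) (δ : ℝ) (m : ℕ) :
    piece β p δ m ⊆ range (loop β p δ) := by
  rw [range_loop_eq hp, ← piece_mod]
  have hQ : 0 < minimalPeriod (nextCorner β) p := minimalPeriod_pos_of_mem_periodicPts hp
  exact subset_iUnion₂ (s := fun m _ ↦ piece β p δ m) (m % (2 * minimalPeriod (nextCorner β) p))
    (Finset.mem_range.2 (Nat.mod_lt _ (by omega)))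

/-- **The time of a point of a piece**: a point of `piece m` (`m < 2Q`) is the value of the rounded
loop at a time `t ∈ [m/2Q, (m+1)/2Q] ⊆ [0, 1]`. [folklore] -/
theorem exists_time_of_mem_piece (hp : p ∈ periodicPts (nextCorner β)) (δ : ℝ) {m : ℕ}
    (hm : m < 2 * minimalPeriod (nextCorner β) p) {z : ℂ} (hz : z ∈ piece β p δ m) :
    ∃ t : ℝ, (m : ℝ) / (2 * minimalPeriod (nextCorner β) p : ℕ) ≤ t ∧
      t ≤ ((m : ℝ) + 1) / (2 * minimalPeriod (nextCorner β) p : ℕ) ∧ t ≤ 1 ∧ 0 ≤ t ∧ loop β p δ t = z := by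
  have hQ : 0 < minimalPeriod (nextCorner β) p := minimalPeriod_pos_of_mem_periodicPts hp
  set N := 2 * minimalPeriod (nextCorner β) p with hN
  have hNpos : 0 < N := by omega
  have hNr : (0 : ℝ) < N := by exact_mod_cast hNpos
  have hval : ∀ u : ℝ, u ∈ Ico (0 : ℝ) 1 → loop β p δ u = PLLoop.interp (vtx β p δ) ((N : ℝ) * u) := by
    intro u hu
    show PLLoop.unitLoop (vtx β p δ) N (Int.fract u) = _
    rw [Int.fract_eq_self.2 hu]
    rfl
  rw [piece, segment_eq_image'] at hz
  obtain ⟨s, ⟨hs0, hs1⟩, rfl⟩ := hz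
  have hm1 : (m : ℝ) + 1 ≤ N := by exact_mod_cast hm
  refine ⟨((m : ℝ) + s) / N, ?_, ?_, ?_, by positivity, ?_⟩
  · gcongr; linarith
  · gcongr
  · rw [div_le_one hNr]; linarith
  rcases lt_or_eq_of_le hs1 with hs1' | rfl
  · have ht : ((m : ℝ) + s) / N ∈ Ico (0 : ℝ) 1 := by
      refine ⟨by positivity, ?_⟩
      rw [div_lt_one hNr]; linarith
    rw [hval _ ht, mul_div_cancel₀ _ hNr.ne', PLLoop.interp_of_mem_Ico (m := m) ⟨by linarith, by linarith⟩]
    simp only [add_sub_cancel_left, Complex.real_smul]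
  · simp only [one_smul, add_sub_cancel]
    rcases Nat.lt_or_ge (m + 1) N with hm1' | hm1'
    · have ht : ((m : ℝ) + 1) / N ∈ Ico (0 : ℝ) 1 := by
        refine ⟨by positivity, ?_⟩
        rw [div_lt_one hNr]; exact_mod_cast hm1'
      rw [hval _ ht, mul_div_cancel₀ _ hNr.ne', show (m : ℝ) + 1 = ((m + 1 : ℕ) : ℝ) by push_cast; ring,
        PLLoop.interp_natCast]
    · have hmN : m + 1 = N := by omega
      have h1 : ((m : ℝ) + 1) / N = 1 := by
        rw [div_eq_one_iff_eq hNr.ne']; exact_mod_cast hmN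
      rw [h1]
      have hper := periodic_loop (β := β) (p := p) δ 0
      rw [zero_add] at hper
      rw [hper, hval 0 ⟨le_rfl, zero_lt_one⟩, mul_zero, show (0 : ℝ) = ((0 : ℕ) : ℝ) by simp,
        PLLoop.interp_natCast, hmN, hN, ← zero_add (2 * minimalPeriod (nextCorner β) p), vtx_add_period]

/-! ### Re-basing the orbit at one of its corners -/

/-- Corners of the re-based orbit. [folklore] -/
theorem corner_corner (j i : ℕ) : corner β (corner β p j) i = corner β p (j + i) := by
  simp only [corner, ← iterate_add_apply, add_comm]

/-- A corner of a periodic orbit is periodic, with the same minimal period. [folklore] -/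
theorem corner_mem_periodicPts (hp : p ∈ periodicPts (nextCorner β)) (j : ℕ) :
    corner β p j ∈ periodicPts (nextCorner β) := by
  rw [corner]
  refine minimalPeriod_pos_iff_mem_periodicPts.1 ?_
  rw [minimalPeriod_apply_iterate hp]
  exact minimalPeriod_pos_of_mem_periodicPts hp

/-- Re-basing does not change the minimal period. [folklore] -/
theorem minimalPeriod_corner (hp : p ∈ periodicPts (nextCorner β)) (j : ℕ) :
    minimalPeriod (nextCorner β) (corner β p j) = minimalPeriod (nextCorner β) p := by
  rw [corner, minimalPeriod_apply_iterate hp]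

/-- `pS` of the re-based orbit. [folklore] -/
theorem pS_corner (δ : ℝ) (j i : ℕ) : pS β (corner β p j) δ i = pS β p δ (j + i) := by
  simp only [pS, cv, cf, corner_corner]

/-- `pT` of the re-based orbit. [folklore] -/
theorem pT_corner (δ : ℝ) (j i : ℕ) : pT β (corner β p j) δ i = pT β p δ (j + i) := by
  simp only [pT, cv, cf, corner_corner]

/-- **Vertices of the re-based rounded loop are shifted by `2j`.** [folklore] -/
theorem vtx_corner (δ : ℝ) (j m : ℕ) : vtx β (corner β p j) δ m = vtx β p δ (m + 2 * j) := by
  have h1 : (m + 2 * j) % 2 = m % 2 := by omega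
  have h2 : (m + 2 * j) / 2 = j + m / 2 := by omega
  simp only [vtx, h1, h2, pS_corner, pT_corner]

/-- **Pieces of the re-based rounded loop are shifted by `2j`.** [folklore] -/
theorem piece_corner (δ : ℝ) (j m : ℕ) : piece β (corner β p j) δ m = piece β p δ (m + 2 * j) := by
  rw [piece, piece, vtx_corner, vtx_corner, show m + 1 + 2 * j = m + 2 * j + 1 by ring]

/-! ### Runs of pieces covering a connected subset of the trace -/

/-- **Two pieces meet only when cyclically adjacent** (index form of `vtx_meet`, indices read
modulo `2Q`). [cite: Smirnov2001, §2] -/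
theorem mod_eq_or_of_piece_inter (hp : p ∈ periodicPts (nextCorner β)) {δ : ℝ} (hδ : 0 < δ) {a b : ℕ}
    (h : (piece β p δ a ∩ piece β p δ b).Nonempty) :
    b % (2 * minimalPeriod (nextCorner β) p) = a % (2 * minimalPeriod (nextCorner β) p) ∨
      b % (2 * minimalPeriod (nextCorner β) p) = (a + 1) % (2 * minimalPeriod (nextCorner β) p) ∨
      a % (2 * minimalPeriod (nextCorner β) p) = (b + 1) % (2 * minimalPeriod (nextCorner β) p) := by
  set N := 2 * minimalPeriod (nextCorner β) p with hN
  have hQ : 0 < minimalPeriod (nextCorner β) p := minimalPeriod_pos_of_mem_periodicPts hp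
  have hNpos : 0 < N := by omega
  obtain ⟨z, hza, hzb⟩ := h
  rw [← piece_mod, piece] at hza hzb
  rcases vtx_meet hp hδ (a % N) (b % N) (Nat.mod_lt _ hNpos) (Nat.mod_lt _ hNpos) z hza hzb with
    h1 | ⟨h2, -⟩ | ⟨h3, -⟩
  · exact Or.inl h1
  · right; left; rwa [Nat.mod_add_mod] at h2
  · right; right; rwa [Nat.mod_add_mod] at h3

/-- **A nonempty connected subset of the trace is covered by a run of consecutive pieces each of
which meets it.**  For a nonempty preconnected `C ⊆ trace Λ` there are `m₀ < 2Q` and `k < 2Q`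
such that every piece `piece (m₀ + i)`, `i ≤ k`, meets `C`, and these pieces cover `C`. (The set
of indices of pieces meeting `C` is cyclically connected, since two pieces meet only when
cyclically adjacent and `C` is connected; a maximal run starting after a gap does it.)
[cite: CamiaNewman2006, §5] -/
theorem exists_run_of_isPreconnected (hp : p ∈ periodicPts (nextCorner β)) {δ : ℝ} (hδ : 0 < δ)
    {C : Set ℂ} (hC : IsPreconnected C) (hCne : C.Nonempty) (hCsub : C ⊆ range (loop β p δ)) :
    ∃ m₀ k : ℕ, m₀ < 2 * minimalPeriod (nextCorner β) p ∧ k < 2 * minimalPeriod (nextCorner β) p ∧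
      (∀ i ≤ k, (piece β p δ (m₀ + i) ∩ C).Nonempty) ∧
      C ⊆ ⋃ i ∈ Finset.range (k + 1), piece β p δ (m₀ + i) := by
  classical
  set N := 2 * minimalPeriod (nextCorner β) p with hN
  have hQ : 0 < minimalPeriod (nextCorner β) p := minimalPeriod_pos_of_mem_periodicPts hp
  have hQ3 : 3 ≤ minimalPeriod (nextCorner β) p := three_le_period hp
  have hNpos : 0 < N := by omega
  -- the predicate "piece `m` meets `C`", `N`-periodic
  set J : ℕ → Prop := fun m ↦ (piece β p δ m ∩ C).Nonempty with hJ
  have hJmod : ∀ m, J (m % N) ↔ J m := fun m ↦ by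
    show (piece β p δ (m % (2 * minimalPeriod (nextCorner β) p)) ∩ C).Nonempty ↔ _
    rw [piece_mod]
  have hJper : ∀ m t, J (m + N * t) ↔ J m := fun m t ↦ by
    rw [← hJmod, Nat.add_mul_mod_self_left, hJmod]
  -- every point of `C` is on a piece meeting `C`
  have hcov : ∀ z ∈ C, ∃ m < N, z ∈ piece β p δ m ∧ J m := by
    intro z hz
    have := hCsub hz
    rw [range_loop_eq hp] at this
    simp only [mem_iUnion, Finset.mem_range, exists_prop] at this
    obtain ⟨m, hm, hzm⟩ := this
    exact ⟨m, hm, hzm, ⟨z, hzm, hz⟩⟩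
  obtain ⟨z₁, hz₁⟩ := hCne
  obtain ⟨m₁, hm₁, -, hJm₁⟩ := hcov z₁ hz₁
  by_cases hall : ∀ m < N, J m
  · -- every piece meets `C`: the whole loop is the run
    refine ⟨0, N - 1, hNpos, by omega, fun i hi ↦ by simpa using hall i (by omega), fun z hz ↦ ?_⟩
    obtain ⟨m, hm, hzm, -⟩ := hcov z hz
    simp only [mem_iUnion, Finset.mem_range, exists_prop, zero_add]
    exact ⟨m, by omega, hzm⟩
  push Not at hall
  obtain ⟨g, hg, hJg⟩ := hall
  -- the first index after the gap `g` whose piece meets `C`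
  set i' : ℕ := (m₁ + (N - 1 - g)) % N with hi'
  have hi'N : i' < N := Nat.mod_lt _ hNpos
  have hgi' : (g + 1 + i') % N = m₁ := by
    rw [hi', Nat.add_mod, Nat.mod_mod, ← Nat.add_mod, show g + 1 + (m₁ + (N - 1 - g)) = m₁ + N * 1 by omega,
      Nat.add_mul_mod_self_left, Nat.mod_eq_of_lt hm₁]
  have hex : ∃ i, J (g + 1 + i) := ⟨i', by rw [← hJmod, hgi']; exact hJm₁⟩
  set i₀ := Nat.find hex with hi₀
  have hJm₀ : J (g + 1 + i₀) := Nat.find_spec hex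
  have hi₀min : ∀ i < i₀, ¬ J (g + 1 + i) := fun i hi ↦ Nat.find_min hex hi
  have hi₀le : i₀ ≤ i' := Nat.find_min' hex (by rw [← hJmod, hgi']; exact hJm₁)
  have hi'ne : i' ≠ N - 1 := by
    intro h
    have : J (g + 1 + i') := by rw [← hJmod, hgi']; exact hJm₁
    rw [h, show g + 1 + (N - 1) = g + N * 1 by omega, hJper] at this
    exact hJg this
  have hi₀N : i₀ ≤ N - 2 := by omega
  set m₀' := g + 1 + i₀ with hm₀'
  -- the predecessor of `m₀'` (and everything congruent to it) misses `C`
  have hprev : ∀ m, (m + 1) % N = m₀' % N → ¬ J m := by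
    intro m hm hJm
    have hpred : ¬ J (g + i₀) := by
      rcases Nat.eq_zero_or_pos i₀ with h0 | h0
      · rw [h0, add_zero]; exact hJg
      · have := hi₀min (i₀ - 1) (by omega)
        rwa [show g + 1 + (i₀ - 1) = g + i₀ by omega] at this
    have key : m % N = (g + i₀) % N := by
      have h1 : (m + 1) % N = (g + i₀ + 1) % N := by
        rw [hm, hm₀', show g + 1 + i₀ = g + i₀ + 1 by ring]
      exact Nat.ModEq.add_right_cancel' 1 h1
    apply hpred
    rw [← hJmod, ← key, hJmod]
    exact hJm
  -- the length of the run starting at `m₀'`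
  have hex2 : ∃ k, ¬ J (m₀' + k + 1) :=
    ⟨N - 2 - i₀, by rw [show m₀' + (N - 2 - i₀) + 1 = g + N * 1 by omega, hJper]; exact hJg⟩
  set k := Nat.find hex2 with hk
  have hJk : ¬ J (m₀' + k + 1) := Nat.find_spec hex2
  have hkmin : ∀ k' < k, J (m₀' + k' + 1) := fun k' hk' ↦ by
    have := Nat.find_min hex2 hk'
    rwa [not_not] at this
  have hkle : k ≤ N - 2 - i₀ := Nat.find_min' hex2 (by
    rw [show m₀' + (N - 2 - i₀) + 1 = g + N * 1 by omega, hJper]; exact hJg)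
  have hkN : k < N := by omega
  have hrun : ∀ i ≤ k, J (m₀' + i) := by
    intro i hi
    rcases Nat.eq_zero_or_pos i with rfl | hi0
    · simpa [hm₀'] using hJm₀
    · have := hkmin (i - 1) (by omega)
      rwa [show m₀' + (i - 1) + 1 = m₀' + i by omega] at this
  -- the run and the rest
  set U : Set ℂ := ⋃ i ∈ Finset.range (k + 1), piece β p δ (m₀' + i) with hU
  set V : Set ℂ := ⋃ m ∈ (Finset.range N).filter (fun m ↦ J m ∧ ∀ i ≤ k, m ≠ (m₀' + i) % N),
    piece β p δ m with hV
  have hUc : IsClosed U := isClosed_biUnion_finset fun i _ ↦ isClosed_piece δ _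
  have hVc : IsClosed V := isClosed_biUnion_finset fun i _ ↦ isClosed_piece δ _
  have hCUV : C ⊆ U ∪ V := by
    intro z hz
    obtain ⟨m, hm, hzm, hJm⟩ := hcov z hz
    by_cases h : ∃ i ≤ k, m = (m₀' + i) % N
    · obtain ⟨i, hi, rfl⟩ := h
      left
      simp only [hU, mem_iUnion, Finset.mem_range, exists_prop]
      exact ⟨i, by omega, by rwa [piece_mod] at hzm⟩
    · push Not at h
      right
      simp only [hV, mem_iUnion, Finset.mem_filter, Finset.mem_range, exists_prop]
      exact ⟨m, ⟨hm, hJm, h⟩, hzm⟩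
  have hCU : (C ∩ U).Nonempty := by
    obtain ⟨z, hzp, hzC⟩ := hrun 0 (Nat.zero_le _)
    refine ⟨z, hzC, ?_⟩
    simp only [hU, mem_iUnion, Finset.mem_range, exists_prop]
    exact ⟨0, by omega, hzp⟩
  -- `C` does not meet `V`: a common point of `U` and `V` contradicts `vtx_meet`
  have hCV : ¬ (C ∩ V).Nonempty := by
    intro hCV
    obtain ⟨z, hzC, hzU, hzV⟩ := (isPreconnected_closed_iff.1 hC) U V hUc hVc hCUV hCU hCV
    simp only [hU, mem_iUnion, Finset.mem_range, exists_prop] at hzU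
    simp only [hV, mem_iUnion, Finset.mem_filter, Finset.mem_range, exists_prop] at hzV
    obtain ⟨i, hi, hzi⟩ := hzU
    obtain ⟨m, ⟨hm, hJm, hmrun⟩, hzm⟩ := hzV
    have hmN : m % N = m := Nat.mod_eq_of_lt hm
    rcases mod_eq_or_of_piece_inter hp hδ (a := m₀' + i) (b := m) ⟨z, hzi, hzm⟩ with h1 | h2 | h3
    · exact hmrun i (by omega) (by rw [← hmN, h1])
    · rcases Nat.lt_or_ge i k with hik | hik
      · exact hmrun (i + 1) (by omega) (by rw [← hmN, h2, add_assoc])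
      · have hieq : i = k := by omega
        apply hJk
        rw [← hJmod, ← hieq, ← h2, hJmod]
        exact hJm
    · rcases Nat.eq_zero_or_pos i with hi0 | hi0
      · rw [hi0, add_zero] at h3
        exact hprev m h3.symm hJm
      · refine hmrun (i - 1) (by omega) ?_
        rw [← hmN]
        have h4 : (m + 1) % N = (m₀' + (i - 1) + 1) % N := by
          rw [← h3, show m₀' + (i - 1) + 1 = m₀' + i by omega]
        exact Nat.ModEq.add_right_cancel' 1 h4
  have hCsubU : C ⊆ U := by
    intro z hz
    rcases hCUV hz with h | h
    · exact h
    · exact (hCV ⟨z, hz, h⟩).elim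
  -- output, with the start index reduced modulo `N`
  refine ⟨m₀' % N, k, Nat.mod_lt _ hNpos, hkN, fun i hi ↦ ?_, ?_⟩
  · rw [← piece_mod, Nat.mod_add_mod, piece_mod]
    exact hrun i hi
  · intro z hz
    have := hCsubU hz
    simp only [hU, mem_iUnion, Finset.mem_range, exists_prop] at this ⊢
    obtain ⟨i, hi, hzi⟩ := this
    refine ⟨i, hi, ?_⟩
    rw [← piece_mod, Nat.mod_add_mod, piece_mod]
    exact hzi

end OrbitPolygon

end Literature.Probability.Percolation

end
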